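import Summits.QuantumFields.YangMills.Theorems.BalabanUVNodesPortS1G3CWalkVanish

/-!
# NODE O port PT-A — `stub_G3C` (repaired edition `G3CAtRecordL`), layer (D4d-b): THE LOCALIZATION OF A NON-VANISHING WALK IS A DOMAIN, with tree length
# `d_j(X(□₀,w)) ≤ d_j(□̃₀) + Σ_i (d_j(Y_i) + d_j(□̃_i) + 4)`; hence `Σ_X W_m(X) = Tr[C₀·Rᵐ]` at the record (memo §5c)

A chain of torus localization domains, each touching the union of the previous ones in a cube, is a localization domain and its tree length is subadditive with
joining cost `2` (✓`TreeLengthTorusGeometry.torusTreeLen_biUnion_add_two_le`, (2.27) sharpened; the two-set touching case re-derived here to stay inside the built closure).  For a walk `(□₀; (□₁,Y₁), …)` whose term does not vanish, layer (D4d-a)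
(✓`…G3CWalkVanish`) gives `□₀ ∈ Y₁`, `□_i ∈ Y_{i+1}`, `Y_i ∩ □̃_i ≠ ∅` — exactly the touching conditions.  Cell `ym-nodeO-ideate`, porter hand `hand-27930-G3C` (g0); proof kind,
`--supports stmt-QuantumFields-27930 --as helper`; count-neutral.

WHAT THIS FILE PROVES (sorry-free): `g3cWalkLoc_zero`, `g3cWalkLoc_succ`, `blk_subset_g3cWalkLoc`, `blk_step_subset_g3cWalkLoc`, `G3CGeom.tlinked_mono`, `G3CGeom.tlinked_symm`, `G3CGeom.tFaceConnected_union_of_mem`,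
`isTDom_union_of_mem` (one touching domain, (2.27) two sets),
★ `isTDom_g3cWalkLoc_of_conn` + `torusTreeLen_g3cWalkLoc_le_of_conn` (pure geometry, by induction on the length), `torusTreeLen_g3cBlk_le` (`d_j(□̃) ≤ 3^d·3^d − 1`),
★ `g3cWalk_conn_of_ne_zero` (the touching conditions of a non-vanishing walk), ★ `isTDom_g3cWalkLoc_of_ne_zero`, ★ `torusTreeLen_g3cWalkLoc_le_of_ne_zero`,
★★ `sum_g3cWm_eq_trace` (`Σ_X W_m(X) = Tr[C₀·Rᵐ]` at the record, every `x`, `φ`).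

HONEST FRAMING.  Geometry∕bookkeeping under the HYPOTHESIS `P0CarrierClauses …` (inhabited nowhere); nothing of Bałaban asserted, ported or discharged; `stub_G3C` NOT closed; 27930 OPEN;
NODE O 0∕1; COUNT 8∕28 · K 1∕4 UNMOVED; **the Yang–Mills mass gap is NOT proved by any of this.**  No `sorry`, no `instance`, no `notation`, no `def`; standard axioms.
-/

noncomputable section

open scoped BigOperators Matrix.Norms.L2Operator Topology Matrix Classical
open Filter Finset

namespace Summit.QuantumFields.YangMills.Theorems.BalabanUVNodesPortS1

open Summit.QuantumFields.YangMills.Theorems.K0RecordFormatNames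
open Literature.MathematicalPhysics.QuantumFieldTheory.Balaban1983to89
open Literature.MathematicalPhysics.QuantumFieldTheory.Balaban1983to89.Node00
open Literature.MathematicalPhysics.QuantumFieldTheory.Balaban1983to89.T4Continuum (T4Family)
open Literature.MathematicalPhysics.QuantumFieldTheory.Balaban1983to89.TreeLengthTorus (TPt TDom TAdj TStepIn TLinked IsTDom TFaceConnected torusTreeLen torusTreeLen_nonneg torusTreeLen_le_card_sub_one)
open Literature.MathematicalPhysics.QuantumFieldTheory.Balaban1983to89.TreeLengthTorusTransfer (tblock tcollar card_tblock_le card_tcollar_le)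
open Literature.MathematicalPhysics.QuantumFieldTheory.Balaban1983to89.TreeLengthTorusGeometry (torusTreeLen_biUnion_add_two_le)

/-! ## Pure geometry of the localization -/

section Geom

variable {F : T4Family}

/-- The localization of the empty walk is `□̃₀`. [folklore] -/
theorem g3cWalkLoc_zero (Mc k K : ℕ) (q₀ : TPt (F.P K).d (Sect2.domCount (F.P K) Mc (k + 1)))
    (w : Fin 0 → TPt (F.P K).d (Sect2.domCount (F.P K) Mc (k + 1)) × (recordDomSys F Mc k K).Dom) :
    g3cWalkLoc F Mc k K q₀ w = (g3cBlk F Mc k K q₀).1 := by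
  rw [g3cWalkLoc, Finset.univ_eq_empty, Finset.biUnion_empty, Finset.union_empty]

/-- Adding a step adds `Y ∪ □̃`. [folklore] -/
theorem g3cWalkLoc_succ (Mc k K : ℕ) (q₀ : TPt (F.P K).d (Sect2.domCount (F.P K) Mc (k + 1))) {m : ℕ}
    (w : Fin (m + 1) → TPt (F.P K).d (Sect2.domCount (F.P K) Mc (k + 1)) × (recordDomSys F Mc k K).Dom) :
    g3cWalkLoc F Mc k K q₀ w =
      g3cWalkLoc F Mc k K q₀ (fun i : Fin m => w i.castSucc) ∪ (((w (Fin.last m)).2.1 : Finset _) ∪ (g3cBlk F Mc k K (w (Fin.last m)).1).1) := by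
  ext c
  simp only [g3cWalkLoc, Finset.mem_union, Finset.mem_biUnion, Finset.mem_univ, true_and]
  constructor
  · rintro (h | ⟨i, hi⟩)
    · exact Or.inl (Or.inl h)
    · by_cases hlast : i = Fin.last m
      · subst hlast; exact Or.inr hi
      · obtain ⟨j, rfl⟩ := Fin.exists_castSucc_eq.2 hlast
        exact Or.inl (Or.inr ⟨j, hi⟩)
  · rintro ((h | ⟨j, hj⟩) | h)
    · exact Or.inl h
    · exact Or.inr ⟨j.castSucc, hj⟩
    · exact Or.inr ⟨Fin.last m, h⟩

/-- `□̃₀ ⊆ X(□₀, w)`. [folklore] -/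
theorem blk_subset_g3cWalkLoc (Mc k K : ℕ) (q₀ : TPt (F.P K).d (Sect2.domCount (F.P K) Mc (k + 1))) {m : ℕ}
    (w : Fin m → TPt (F.P K).d (Sect2.domCount (F.P K) Mc (k + 1)) × (recordDomSys F Mc k K).Dom) :
    ((g3cBlk F Mc k K q₀).1 : Finset _) ⊆ g3cWalkLoc F Mc k K q₀ w := by
  rw [g3cWalkLoc]; exact Finset.subset_union_left

/-- `□̃_i ⊆ X(□₀, w)`. [folklore] -/
theorem blk_step_subset_g3cWalkLoc (Mc k K : ℕ) (q₀ : TPt (F.P K).d (Sect2.domCount (F.P K) Mc (k + 1))) {m : ℕ}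
    (w : Fin m → TPt (F.P K).d (Sect2.domCount (F.P K) Mc (k + 1)) × (recordDomSys F Mc k K).Dom) (i : Fin m) :
    ((g3cBlk F Mc k K (w i).1).1 : Finset _) ⊆ g3cWalkLoc F Mc k K q₀ w := by
  intro c hc
  rw [g3cWalkLoc, Finset.mem_union, Finset.mem_biUnion]
  exact Or.inr ⟨i, Finset.mem_univ _, Finset.mem_union.2 (Or.inr hc)⟩

/-- `TLinked` is monotone in the ambient family. [folklore] -/
theorem G3CGeom.tlinked_mono {d N : ℕ} {S S' : Finset (TPt d N)} (h : S ⊆ S') {x y : TPt d N} (hl : TLinked S x y) : TLinked S' x y := by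
  unfold TLinked at *
  induction hl with
  | refl => exact Relation.ReflTransGen.refl
  | tail _ hbc ih => exact Relation.ReflTransGen.tail ih ⟨h hbc.1, h hbc.2.1, hbc.2.2⟩

/-- `TLinked` is symmetric (torus walls are). [folklore] -/
theorem G3CGeom.tlinked_symm {d N : ℕ} {S : Finset (TPt d N)} {x y : TPt d N} (hl : TLinked S x y) : TLinked S y x := by
  unfold TLinked at *
  induction hl with
  | refl => exact Relation.ReflTransGen.refl
  | tail _ hbc ih => exact Relation.ReflTransGen.head ⟨hbc.2.1, hbc.1, hbc.2.2.symm⟩ ih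

/-- **Two touching domains**: `Z₀ ∪ Y` is wall-connected when the wall-connected `Z₀`, `Y` share a cube. [cite: Balaban1987RG1, p.257 (localization domains)] -/
theorem G3CGeom.tFaceConnected_union_of_mem {d N : ℕ} {Z₀ Y : Finset (TPt d N)} (hZ₀ : TFaceConnected Z₀) (hY : TFaceConnected Y) {a : TPt d N}
    (haZ : a ∈ Z₀) (haY : a ∈ Y) : TFaceConnected (Z₀ ∪ Y) := by
  have key : ∀ x ∈ Z₀ ∪ Y, TLinked (Z₀ ∪ Y) x a := by
    intro x hx
    rcases Finset.mem_union.1 hx with hx | hx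
    · exact G3CGeom.tlinked_mono Finset.subset_union_left (hZ₀ x hx a haZ)
    · exact G3CGeom.tlinked_mono Finset.subset_union_right (hY x hx a haY)
  intro x hx y hy
  exact Relation.ReflTransGen.trans (key x hx) (G3CGeom.tlinked_symm (key y hy))

/-- **One touching domain**: `Z₀ ∪ Y` is a domain with `d_j ≤ d_j(Z₀) + d_j(Y) + 2` when the domain `Y` contains a cube of the domain `Z₀` ((2.27) sharpened, two sets).
[cite: Balaban1988RG2Cluster, (2.27) p.18] -/
theorem isTDom_union_of_mem {d N : ℕ} [NeZero N] {Z₀ Y : Finset (TPt d N)} (hZ₀ : IsTDom Z₀) (hY : IsTDom Y) {a : TPt d N} (haZ : a ∈ Z₀) (haY : a ∈ Y) :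
    IsTDom (Z₀ ∪ Y) ∧ torusTreeLen (Z₀ ∪ Y) ≤ torusTreeLen Z₀ + (torusTreeLen Y + 2) := by
  classical
  have hU : TFaceConnected (Z₀ ∪ Y) := G3CGeom.tFaceConnected_union_of_mem hZ₀.2 hY.2 haZ haY
  refine ⟨⟨⟨a, Finset.mem_union.2 (Or.inl haZ)⟩, hU⟩, ?_⟩
  by_cases hZY : Z₀ = Y
  · subst hZY
    rw [Finset.union_idempotent]
    linarith [torusTreeLen_nonneg Z₀]
  · have hD : ({Z₀, Y} : Finset (Finset (TPt d N))).biUnion id = Z₀ ∪ Y := by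
      rw [Finset.biUnion_insert, Finset.singleton_biUnion]; rfl
    have hmem : ∀ Y' ∈ ({Z₀, Y} : Finset (Finset (TPt d N))), Y'.Nonempty ∧ TFaceConnected Y' := by
      intro Y' hY'
      rcases Finset.mem_insert.1 hY' with h | h
      · rw [h]; exact hZ₀
      · rw [Finset.mem_singleton] at h; rw [h]; exact hY
    have h := torusTreeLen_biUnion_add_two_le (d := d) (N := N) (D := {Z₀, Y}) ⟨Z₀, Finset.mem_insert_self _ _⟩ hmem (hD ▸ hU)
    rw [hD, Finset.sum_pair hZY] at h
    linarith

/-- ★ **Geometry of connected walks**: if `□₀ ∈ Y₁`, `□_i ∈ Y_{i+1}` and every `Y_i` meets `□̃_i`, then `X(□₀, w)` is a domain and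
`d_j(X(□₀,w)) ≤ d_j(□̃₀) + Σ_i (d_j(Y_i) + d_j(□̃_i) + 4)`. [cite: Balaban1988RG2Cluster, (2.27) p.18; Balaban1987RG1, p.257] -/
theorem isTDom_g3cWalkLoc_of_conn (Mc k K : ℕ) (q₀ : TPt (F.P K).d (Sect2.domCount (F.P K) Mc (k + 1))) :
    ∀ (m : ℕ) (w : Fin m → TPt (F.P K).d (Sect2.domCount (F.P K) Mc (k + 1)) × (recordDomSys F Mc k K).Dom),
      (∀ i : Fin m, i.val = 0 → q₀ ∈ ((w i).2.1 : Finset _)) →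
      (∀ i j : Fin m, j.val = i.val + 1 → (w i).1 ∈ ((w j).2.1 : Finset _)) →
      (∀ i : Fin m, ∃ c ∈ ((w i).2.1 : Finset _), c ∈ ((g3cBlk F Mc k K (w i).1).1 : Finset _)) →
      IsTDom (g3cWalkLoc F Mc k K q₀ w) ∧
        torusTreeLen (g3cWalkLoc F Mc k K q₀ w) ≤ torusTreeLen ((g3cBlk F Mc k K q₀).1 : Finset _) +
          ∑ i : Fin m, (torusTreeLen ((w i).2.1 : Finset _) + torusTreeLen ((g3cBlk F Mc k K (w i).1).1 : Finset _) + 4) := by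
  intro m
  induction m with
  | zero =>
      intro w _ _ _
      rw [g3cWalkLoc_zero]
      simp only [Finset.univ_eq_empty, Finset.sum_empty, add_zero, le_refl, and_true]
      exact (g3cBlk F Mc k K q₀).2
  | succ m ih =>
      intro w h0 hc hb
      -- the initial segment
      set w' : Fin m → TPt (F.P K).d (Sect2.domCount (F.P K) Mc (k + 1)) × (recordDomSys F Mc k K).Dom := fun i => w i.castSucc with hw'
      have h0' : ∀ i : Fin m, i.val = 0 → q₀ ∈ ((w' i).2.1 : Finset _) := fun i hi => h0 i.castSucc (by simpa using hi)
      have hc' : ∀ i j : Fin m, j.val = i.val + 1 → (w' i).1 ∈ ((w' j).2.1 : Finset _) := fun i j hij => hc i.castSucc j.castSucc (by simpa using hij)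
      have hb' : ∀ i : Fin m, ∃ c ∈ ((w' i).2.1 : Finset _), c ∈ ((g3cBlk F Mc k K (w' i).1).1 : Finset _) := fun i => hb i.castSucc
      obtain ⟨hD', hlen'⟩ := ih w' h0' hc' hb'
      -- the touching cube of the last piece
      set Y := (w (Fin.last m)).2 with hYdef
      set qL := (w (Fin.last m)).1 with hqL
      have htouchY : ∃ a, a ∈ g3cWalkLoc F Mc k K q₀ w' ∧ a ∈ (Y.1 : Finset _) := by
        rcases Nat.eq_zero_or_pos m with hm | hm
        · subst hm
          exact ⟨q₀, blk_subset_g3cWalkLoc Mc k K q₀ w' (mem_g3cBlk_self Mc k K q₀), h0 (Fin.last 0) rfl⟩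
        · have hi : (⟨m - 1, by omega⟩ : Fin (m + 1)) = (⟨m - 1, by omega⟩ : Fin m).castSucc := Fin.ext rfl
          refine ⟨(w ⟨m - 1, by omega⟩).1, ?_, hc ⟨m - 1, by omega⟩ (Fin.last m) (by simp [Fin.val_last]; omega)⟩
          rw [hi]
          exact blk_step_subset_g3cWalkLoc Mc k K q₀ w' ⟨m - 1, by omega⟩ (mem_g3cBlk_self Mc k K _)
      obtain ⟨a, haZ, haY⟩ := htouchY
      obtain ⟨hD1, hlen1⟩ := isTDom_union_of_mem hD' Y.2 haZ haY
      -- the block of the last step touches the last piece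
      obtain ⟨c, hcY, hcB⟩ := hb (Fin.last m)
      obtain ⟨hD2, hlen2⟩ := isTDom_union_of_mem hD1 (g3cBlk F Mc k K qL).2 (Finset.mem_union.2 (Or.inr hcY)) hcB
      have e : g3cWalkLoc F Mc k K q₀ w = g3cWalkLoc F Mc k K q₀ w' ∪ (Y.1 : Finset _) ∪ ((g3cBlk F Mc k K qL).1 : Finset _) := by
        rw [g3cWalkLoc_succ, Finset.union_assoc]
      rw [e]
      refine ⟨hD2, hlen2.trans ?_⟩
      rw [Fin.sum_univ_castSucc]
      have : ∑ i : Fin m, (torusTreeLen (((w i.castSucc).2).1 : Finset _) + torusTreeLen ((g3cBlk F Mc k K (w i.castSucc).1).1 : Finset _) + 4) =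
          ∑ i : Fin m, (torusTreeLen ((w' i).2.1 : Finset _) + torusTreeLen ((g3cBlk F Mc k K (w' i).1).1 : Finset _) + 4) := rfl
      rw [this]
      linarith

/-- `d_j(□̃) ≤ 3^d·3^d − 1`. [cite: Balaban1987RG1, p.257 (bookkeeping)] -/
theorem torusTreeLen_g3cBlk_le (Mc k K : ℕ) (q : TPt (F.P K).d (Sect2.domCount (F.P K) Mc (k + 1))) :
    torusTreeLen ((g3cBlk F Mc k K q).1 : Finset _) ≤ (3 ^ (F.P K).d * 3 ^ (F.P K).d : ℕ) - 1 := by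
  have h1 := torusTreeLen_le_card_sub_one (g3cBlk F Mc k K q).2.1 (g3cBlk F Mc k K q).2.2
  have h2 : ((g3cBlk F Mc k K q).1 : Finset _).card ≤ 3 ^ (F.P K).d * 3 ^ (F.P K).d := by
    show (tcollar (tblock q)).card ≤ _
    exact (card_tcollar_le _).trans (Nat.mul_le_mul_left _ (card_tblock_le q))
  have h3 : (((g3cBlk F Mc k K q).1 : Finset _).card : ℝ) ≤ (3 ^ (F.P K).d * 3 ^ (F.P K).d : ℕ) := by exact_mod_cast h2
  linarith

end Geom

/-! ## At the record: non-vanishing walks are connected -/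

section Record

variable {F : T4Family}
variable {a₀ δ₀ c₀ γ₀ γ₁ δ₁ : ℝ} {Mc : ℕ} {α₀ α₁ ε₂₉ : ℝ} {k : ℕ}
variable {TC : (n : ℕ) → Sect2.CPair (F.P (recordK₀ F Mc k + n)) (MatA 2) → FluctIdx F k (recordK₀ F Mc k + n) → FluctIdx F k (recordK₀ F Mc k + n) → ℂ}
variable {TY : (n : ℕ) → (recordDomSys F Mc k (recordK₀ F Mc k + n)).Dom → Sect2.CPair (F.P (recordK₀ F Mc k + n)) (MatA 2) →
  FluctIdx F k (recordK₀ F Mc k + n) → FluctIdx F k (recordK₀ F Mc k + n) → ℂ}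
variable {TZY : Finset (Fin 4 → ℤ) → IntBondCfg → ((Fin 4 → ℤ) × Fin 4) × Fin 3 → ((Fin 4 → ℤ) × Fin 4) × Fin 3 → ℂ}
variable {AdM : (n : ℕ) → (Site (F.P (recordK₀ F Mc k + n)) 0 → (MatA 2)ˣ) →
  Matrix (FluctIdx F k (recordK₀ F Mc k + n)) (FluctIdx F k (recordK₀ F Mc k + n)) ℂ}
variable {AdZ : ((Fin 4 → ℤ) → (MatA 2)ˣ) → (Fin 4 → ℤ) × Fin 4 → Matrix (Fin 3) (Fin 3) ℂ}

/-- ★ **A non-vanishing walk is connected**: `□₀ ∈ Y₁`, `□_i ∈ Y_{i+1}`, `Y_i ∩ □̃_i ≠ ∅`. [cite: Balaban1985BackgroundPropagators, (3.90) p.409] -/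
theorem g3cWalk_conn_of_ne_zero (hP : P0CarrierClauses F a₀ δ₀ c₀ γ₀ γ₁ Mc α₀ α₁ ε₂₉ k TC TY TZY AdM AdZ) (hMc : McGuard F Mc) (n : ℕ) (x : ℝ)
    (φ : Sect2.CPair (F.P (recordK₀ F Mc k + n)) (MatA 2)) (q₀ : TPt (F.P (recordK₀ F Mc k + n)).d (Sect2.domCount (F.P (recordK₀ F Mc k + n)) Mc (k + 1))) {m : ℕ}
    (w : Fin m → TPt (F.P (recordK₀ F Mc k + n)).d (Sect2.domCount (F.P (recordK₀ F Mc k + n)) Mc (k + 1)) × (recordDomSys F Mc k (recordK₀ F Mc k + n)).Dom)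
    (ht : g3cWalkTerm F Mc k (recordK₀ F Mc k + n) (TY n) x φ q₀ w ≠ 0) :
    (∀ i : Fin m, i.val = 0 → q₀ ∈ ((w i).2.1 : Finset _)) ∧
    (∀ i j : Fin m, j.val = i.val + 1 → (w i).1 ∈ ((w j).2.1 : Finset _)) ∧
    (∀ i : Fin m, ∃ c ∈ ((w i).2.1 : Finset _), c ∈ ((g3cBlk F Mc k (recordK₀ F Mc k + n) (w i).1).1 : Finset _)) := by
  refine ⟨fun i hi => ?_, fun i j hij => ?_, fun i => ?_⟩
  · by_contra h
    cases m with
    | zero => exact i.elim0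
    | succ m =>
        have hi0 : i = 0 := Fin.ext hi
        subst hi0
        exact ht (g3cWalkTerm_eq_zero_of_root_not_mem hP hMc n x φ q₀ w h)
  · by_contra h
    exact ht (g3cWalkTerm_eq_zero_of_consec_not_mem hP hMc n x φ q₀ w i j hij h)
  · by_contra h
    simp only [not_exists, not_and] at h
    exact ht (g3cWalkTerm_eq_zero_of_disjoint hP hMc n x φ q₀ w i h)

/-- ★ **The localization of a non-vanishing walk is a domain.** [cite: Balaban1987RG1, (1.7) p.261, p.257] -/
theorem isTDom_g3cWalkLoc_of_ne_zero (hP : P0CarrierClauses F a₀ δ₀ c₀ γ₀ γ₁ Mc α₀ α₁ ε₂₉ k TC TY TZY AdM AdZ) (hMc : McGuard F Mc) (n : ℕ) (x : ℝ)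
    (φ : Sect2.CPair (F.P (recordK₀ F Mc k + n)) (MatA 2)) (q₀ : TPt (F.P (recordK₀ F Mc k + n)).d (Sect2.domCount (F.P (recordK₀ F Mc k + n)) Mc (k + 1))) {m : ℕ}
    (w : Fin m → TPt (F.P (recordK₀ F Mc k + n)).d (Sect2.domCount (F.P (recordK₀ F Mc k + n)) Mc (k + 1)) × (recordDomSys F Mc k (recordK₀ F Mc k + n)).Dom)
    (ht : g3cWalkTerm F Mc k (recordK₀ F Mc k + n) (TY n) x φ q₀ w ≠ 0) :
    IsTDom (g3cWalkLoc F Mc k (recordK₀ F Mc k + n) q₀ w) := by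
  obtain ⟨h0, hc, hb⟩ := g3cWalk_conn_of_ne_zero hP hMc n x φ q₀ w ht
  exact (isTDom_g3cWalkLoc_of_conn Mc k _ q₀ m w h0 hc hb).1

/-- ★ **Tree length of the localization of a non-vanishing walk**: `d_j(X(□₀,w)) ≤ d_j(□̃₀) + Σ_i (d_j(Y_i) + d_j(□̃_i) + 4)`. [cite: Balaban1988RG2Cluster, (2.27) p.18; Balaban1985UV3, p.262] -/
theorem torusTreeLen_g3cWalkLoc_le_of_ne_zero (hP : P0CarrierClauses F a₀ δ₀ c₀ γ₀ γ₁ Mc α₀ α₁ ε₂₉ k TC TY TZY AdM AdZ) (hMc : McGuard F Mc) (n : ℕ) (x : ℝ)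
    (φ : Sect2.CPair (F.P (recordK₀ F Mc k + n)) (MatA 2)) (q₀ : TPt (F.P (recordK₀ F Mc k + n)).d (Sect2.domCount (F.P (recordK₀ F Mc k + n)) Mc (k + 1))) {m : ℕ}
    (w : Fin m → TPt (F.P (recordK₀ F Mc k + n)).d (Sect2.domCount (F.P (recordK₀ F Mc k + n)) Mc (k + 1)) × (recordDomSys F Mc k (recordK₀ F Mc k + n)).Dom)
    (ht : g3cWalkTerm F Mc k (recordK₀ F Mc k + n) (TY n) x φ q₀ w ≠ 0) :
    torusTreeLen (g3cWalkLoc F Mc k (recordK₀ F Mc k + n) q₀ w) ≤ torusTreeLen ((g3cBlk F Mc k (recordK₀ F Mc k + n) q₀).1 : Finset _) +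
      ∑ i : Fin m, (torusTreeLen ((w i).2.1 : Finset _) + torusTreeLen ((g3cBlk F Mc k (recordK₀ F Mc k + n) (w i).1).1 : Finset _) + 4) := by
  obtain ⟨h0, hc, hb⟩ := g3cWalk_conn_of_ne_zero hP hMc n x φ q₀ w ht
  exact (isTDom_g3cWalkLoc_of_conn Mc k _ q₀ m w h0 hc hb).2

/-- ★★ **`Σ_X W_m(X) = Tr[C₀·Rᵐ]` AT THE RECORD**, for every `x`, `φ`, `m` (the finite-order bookkeeping of the walk expansion). [cite: Balaban1985BackgroundPropagators, (3.90) p.409; Balaban1987RG1, (1.7) p.261] -/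
theorem sum_g3cWm_eq_trace (hP : P0CarrierClauses F a₀ δ₀ c₀ γ₀ γ₁ Mc α₀ α₁ ε₂₉ k TC TY TZY AdM AdZ) (hMc : McGuard F Mc) (n : ℕ) (x : ℝ)
    (φ : Sect2.CPair (F.P (recordK₀ F Mc k + n)) (MatA 2)) (m : ℕ) :
    ∑ X : (recordDomSys F Mc k (recordK₀ F Mc k + n)).Dom, g3cWm F Mc k (recordK₀ F Mc k + n) (TY n) x φ m X =
      (g3cC0 F Mc k (recordK₀ F Mc k + n) (TY n) x φ * g3cR F Mc k (recordK₀ F Mc k + n) (TC n) (TY n) x φ ^ m).trace := by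
  rw [trace_C0_mul_R_pow hP n x φ m]
  exact sum_g3cWm_eq Mc k (TY n) x φ m (fun q₀ w ht => isTDom_g3cWalkLoc_of_ne_zero hP hMc n x φ q₀ w ht)

end Record

end Summit.QuantumFields.YangMills.Theorems.BalabanUVNodesPortS1

end
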